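import Mathlib
import HarnessLib
import Summits.AtomisticToContinuum.Crystallization.Theses.FlatToriSuffice

/-!
# Line `exact-rules-compactness` — birth skeleton of `TwoShellLocalRules`
(X_L of the scale split of `TorusDefectGap`; item `stmt-AtomisticToContinuum-17669`, rank 5,
route `FlatToriSuffice`)

`TwoShellLocalRules` (ROBUST two-shell local rules at every periodic LJ minimiser `P₀`: for every
target `(R, ε)` there are `η, L > 0` such that in any periodic `P` a point all of whose
`L`-neighbours are `(2, η)`-good is `(R, ε)`-good) ⟸ two stubs and a PROVED composition:

* `stub_exactLocalRules` — EXACT TWO-SHELL LOCAL RULES FOR POINT SETS (the content; Delone–Dolbilin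
  local theory specialised to the atlas of radius-2 clusters of `P₀`): for every `R` there is `L`
  such that in ANY set `X ⊆ ℝ³`, a point all of whose `L`-neighbours in `X` have their OPEN
  radius-2 environment EXACTLY congruent (tolerance 0, after a linear isometry) to a site
  environment of `P₀` has its closed radius-`R` environment exactly congruent to a site environment.
  Stated for sets, not periodic configurations, because the compactness step produces a mere set.
* `stub_limitExtraction` — LIMIT EXTRACTION (soft; compactness of closed sets under local Hausdorff /
  Kuratowski convergence, `O(3)` compact, `P₀` locally finite; cf. tree `LocalMatchingCompactness`):
  if the robust rules fail for `(R, ε)` at EVERY `(η, L)`, recentre the failing configurations at the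
  bad point and pass to a Kuratowski limit `X ∋ 0`: every point of `X` is exactly two-shell-good on the
  OPEN ball (limits of `(2, η_n)`-good points, `η_n → 0`; strict inequalities survive the limit), while
  `0` is NOT exactly `(R+1)`-good on the closed ball (else `0` would be `(R, ε)`-good in the
  approximants, by two-sided local Hausdorff convergence with slack `1`).
* `TwoShellLocalRules_of` — PROVED composition (contraposition + the radius bookkeeping `R ↦ R + 1`).

Multiplicity (several points of `P` within `η` of one image point — invisible to the matching) is
harmless: clusters of diameter `≤ η_n → 0` collapse to single points of the limit SET.
-/

namespace Summit.AtomisticToContinuum.Crystallization.Cruxes.TwoShellLocalRules.ExactRulesCompactness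

open Literature.MathematicalPhysics.StatisticalMechanics
open Summit.AtomisticToContinuum.Crystallization.Theses.FlatToriSuffice (TwoShellLocalRules)

local notation "E3" => EuclideanSpace ℝ (Fin 3)
local notation "PC" => Literature.MathematicalPhysics.StatisticalMechanics.PeriodicConfiguration 3

/-- `(R, ε)`-goodness of `x` relative to `P₀` for a general point SET `X` (the matching clauses of
`TwoShellLocalRules` verbatim, with `X` for `P.points`). -/
def GoodSet (P₀ : PC) (X : Set E3) (R ε : ℝ) (x : E3) : Prop :=
  ∃ p₀ ∈ P₀.motif, ∃ A : E3 ≃ₗᵢ[ℝ] E3,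
    (∀ p ∈ P₀.points, dist p p₀ ≤ R → ∃ y ∈ X, dist y (x + A (p - p₀)) ≤ ε) ∧
    (∀ y ∈ X, dist y x ≤ R → ∃ p ∈ P₀.points, dist y (x + A (p - p₀)) ≤ ε)

/-- EXACT goodness on the OPEN ball of radius `R` (tolerance `0`). -/
def ExactOpen (P₀ : PC) (X : Set E3) (R : ℝ) (x : E3) : Prop :=
  ∃ p₀ ∈ P₀.motif, ∃ A : E3 ≃ₗᵢ[ℝ] E3,
    (∀ p ∈ P₀.points, dist p p₀ < R → x + A (p - p₀) ∈ X) ∧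
    (∀ y ∈ X, dist y x < R → ∃ p ∈ P₀.points, y = x + A (p - p₀))

/-- EXACT goodness on the CLOSED ball of radius `R` (tolerance `0`). -/
def ExactClosed (P₀ : PC) (X : Set E3) (R : ℝ) (x : E3) : Prop :=
  ∃ p₀ ∈ P₀.motif, ∃ A : E3 ≃ₗᵢ[ℝ] E3,
    (∀ p ∈ P₀.points, dist p p₀ ≤ R → x + A (p - p₀) ∈ X) ∧
    (∀ y ∈ X, dist y x ≤ R → ∃ p ∈ P₀.points, y = x + A (p - p₀))

/-- `P₀` is a periodic LJ minimiser. -/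
def IsMin (P₀ : PC) : Prop :=
  IsLeast (Set.range fun Q : PC => Q.energyPerParticle lennardJones)
    (P₀.energyPerParticle lennardJones)

/-- STUB 1 statement — EXACT TWO-SHELL LOCAL RULES for point sets at every periodic minimiser. -/
def ExactLocalRules : Prop :=
  ∀ P₀ : PC, IsMin P₀ → ∀ R : ℝ, 0 < R → ∃ L : ℝ, 0 < L ∧ ∀ X : Set E3, ∀ x ∈ X,
    (∀ y ∈ X, dist y x ≤ L → ExactOpen P₀ X 2 y) → ExactClosed P₀ X R x

/-- STUB 2 statement — LIMIT EXTRACTION by compactness. -/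
def LimitExtraction : Prop :=
  ∀ P₀ : PC, ∀ R ε : ℝ, 0 < R → 0 < ε →
    (∀ η L : ℝ, 0 < η → 0 < L → ∃ P : PC, ∃ x ∈ P.points,
      (∀ y ∈ P.points, dist y x ≤ L → GoodSet P₀ P.points 2 η y) ∧ ¬ GoodSet P₀ P.points R ε x) →
    ∃ X : Set E3, (0 : E3) ∈ X ∧ (∀ y ∈ X, ExactOpen P₀ X 2 y) ∧ ¬ ExactClosed P₀ X (R + 1) 0

/-- **Stub 1 — exact two-shell local rules (the content of X_L).** For a periodic LJ minimiser
`P₀` and every radius `R` there is `L` such that, in any point set `X`, a point whose `L`-neighbours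
all have their open radius-2 environment exactly congruent to a `P₀`-site environment has its
closed radius-`R` environment exactly congruent to a `P₀`-site environment. For `P₀` = hcp with
nearest-neighbour distance `a* ≈ 0.971` the open 2-ball sees the shells `a*·(1, √2, √(8/3), √3,
√(11/3), 2)`, i.e. both adjacent layers AND the `h`-type pair at `√(8/3)a*`, which pins the stacking
letter of every layer; propagation along nearest-neighbour chains (each 2-ball contains the first
shells of the 12 neighbours) is the local theorem of Delone–Dolbilin–Shtogrin–Galiulin for this
atlas. Unknown minimisers with period `> 2` would break it (why it might fail). -/
theorem stub_exactLocalRules : ExactLocalRules := by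
  sorry

/-- **Stub 2 — limit extraction (compactness).** From failing configurations at `(η, L) = (1/n, n)`
recentred at their bad point, extract a Kuratowski-convergent subsequence of the closed sets
`P_n.points − x_n`; the limit set `X ∋ 0` is exactly two-shell-good on open balls at every point and
not exactly `(R+1)`-good at `0` (two-sided local Hausdorff convergence, `O(3)` compact, `P₀` locally
finite so matched sites stabilise along subsequences). Size M–L; tree: `kuratowskiLiminf`,
`exists_subseq_mem_kuratowskiLiminf_of_frequently` (LocalMatchingCompactness). -/
theorem stub_limitExtraction : LimitExtraction := by
  sorry

namespace Registered
/-- registered stub signature -/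
abbrev stub_exactLocalRules : Prop := ExactLocalRules
/-- registered stub signature -/
abbrev stub_limitExtraction : Prop := LimitExtraction
end Registered

/-- **Composition (proved).** Exact local rules for sets + limit extraction ⇒ the robust two-shell
local rules `TwoShellLocalRules` (by contraposition: a failure at every `(η, L)` yields a limit set
that is exactly two-shell-good everywhere but not exactly `(R+1)`-good at `0`, contradicting the
exact rules at radius `R + 1`). -/
theorem TwoShellLocalRules_of (h1 : Registered.stub_exactLocalRules)
    (h2 : Registered.stub_limitExtraction) :
    TwoShellLocalRules := by
  intro P₀ hmin R ε hR hε
  by_contra hfail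
  have hall : ∀ η L : ℝ, 0 < η → 0 < L → ∃ P : PC, ∃ x ∈ P.points,
      (∀ y ∈ P.points, dist y x ≤ L → GoodSet P₀ P.points 2 η y) ∧
        ¬ GoodSet P₀ P.points R ε x := by
    intro η L hη hL
    by_contra hcon
    apply hfail
    refine ⟨η, L, hη, hL, fun P x hx hyp => ?_⟩
    by_contra hbad
    exact hcon ⟨P, x, hx, hyp, hbad⟩
  obtain ⟨X, h0, hexact, hbad⟩ := h2 P₀ R ε hR hε hall
  obtain ⟨L, -, hrule⟩ := h1 P₀ hmin (R + 1) (by linarith)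
  exact hbad (hrule X 0 h0 fun y hy _ => hexact y hy)

end Summit.AtomisticToContinuum.Crystallization.Cruxes.TwoShellLocalRules.ExactRulesCompactness
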